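import Mathlib
import Summits.Ventures.PercRepro.TriangleCapFourBelowPrivateCount
import Summits.Ventures.PercRepro.TriangleCapFourBelowResidueA
import Summits.Ventures.PercRepro.TriangleCapFourBelowOneTriangle
import Summits.Ventures.PercRepro.TriangleCapFourBelowResidueD

/-!
# PercRepro — THE ONE-TRIANGLE RESIDUE AT `r = 4` ON THE CELLS `m = 4k − 20`, `k ≥ 13` (p3, gen 39; part 133)

The residue of `dense_stability_four_modulo_few_outer` on the cells `a = 4` of the sub-diagonal `r = 4`:
`m + 20 = 4k`, at most ONE outer vertex (the outer count `_of_outer'` pays for `q ≥ 2`), `u` the triangle vertex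
with the largest private set.  Cases on `r = t_v + t_w`: `q = 0`: `r ≤ 2` is not dense, `r = 3` needs
`A_P ≥ 2` only when one private set is empty (then no edge in `R`, `Σ a_y = 3t − 2`, `A_P ≥ 2 (t − 2)` by the
deficit bound), `r ≥ 4` by `σ` alone; `q = 1`: `r ≤ 1` is not dense, `r = 2` by the exact outer accounting
`2 D_out ≥ 2 Σ_R a_y + q_R − 2 Σ_Y a_y − 2`, `r ≥ 3` by `D_out ≥ 2`.  Axioms: standard.
-/

namespace PercRepro

namespace TriangleCap

namespace C047

open Finset

variable {V : Type*} [Fintype V] [DecidableEq V]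

set_option maxHeartbeats 1000000 in
/-- **THE ONE-TRIANGLE RESIDUE ON THE CELLS `m = 4k − 20`, `k ≥ 13`** (`u` the triangle vertex with the largest
private set, every degree `≥ 2`, at most one outer vertex): `Σ_v d(v)² + 4 (k − 5) ≤ m k`. -/
theorem one_triangle_residue_four (D : SimpleGraph V) [DecidableRel D.Adj] (hK : K4mFree D)
    {u v w : V} (huv : D.Adj u v) (huw : D.Adj u w) (hvw : D.Adj v w)
    (hT : ∀ a b c, D.Adj a b → D.Adj a c → D.Adj b c → a = u ∨ a = v ∨ a = w) (hk : 13 ≤ Fintype.card V)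
    (hdeg : ∀ z, 2 ≤ deg D z)
    (hmv : degIn D ({u, v, w} : Finset V)ᶜ v ≤ degIn D ({u, v, w} : Finset V)ᶜ u)
    (hmw : degIn D ({u, v, w} : Finset V)ᶜ w ≤ degIn D ({u, v, w} : Finset V)ᶜ u)
    (hm : D.edgeFinset.card + 20 = 4 * Fintype.card V)
    (hq : ((({u, v, w} : Finset V)ᶜ).filter (fun z => degIn D {u, v, w} z = 0)).card ≤ 1) :
    ∑ v, deg D v * deg D v + 4 * (Fintype.card V - 5) ≤ D.edgeFinset.card * Fintype.card V := by
  apply one_triangle_stability_four_of_private D hK huv huw hvw hT (by omega)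
  set S : Finset V := {u, v, w} with hS
  set P : Finset V := Sᶜ.filter (fun x => D.Adj u x) with hP
  set Q : Finset V := Sᶜ.filter (fun z => degIn D S z = 0) with hQ
  clear_value S P Q
  have h3 : S.card = 3 := by rw [hS]; exact card_triple huv.ne huw.ne hvw.ne
  have hcl : ∀ x ∈ S, ∀ y ∈ S, x ≠ y → D.Adj x y := by rw [hS]; exact clique_triple D huv huw hvw
  have hone : ∀ z ∈ Sᶜ, degIn D S z ≤ 1 := fun z hz => by
    rw [hS] at hz ⊢; exact degIn_le_one_of_triangle D hK huv huw hvw (mem_compl.mp hz)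
  have hnotri : ∀ y ∈ Sᶜ, ∀ y' ∈ Sᶜ, ∀ t ∈ Sᶜ, D.Adj y y' → D.Adj y t → D.Adj y' t → False := by
    intro y hy y' _ t _ hyy' hyt _
    rw [mem_compl, hS] at hy
    simp only [mem_insert, mem_singleton, not_or] at hy
    rcases hT y y' t hyy' hyt (by assumption) with h | h | h
    · exact hy.1 h
    · exact hy.2.1 h
    · exact hy.2.2 h
  have hPS : P ⊆ Sᶜ := by rw [hP]; exact filter_subset _ _
  have hPind : ∀ x ∈ P, ∀ x' ∈ P, ¬ D.Adj x x' := by rw [hP, hS]; exact priv_indep D hT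
  have hQR : Q ⊆ Sᶜ \ P := by
    intro z hz
    rw [hQ, mem_filter] at hz
    rw [mem_sdiff, hP, mem_filter]
    refine ⟨hz.1, fun h => ?_⟩
    have : 1 ≤ degIn D S z := by
      unfold degIn
      apply card_pos.mpr
      exact ⟨u, mem_filter.mpr ⟨by rw [hS]; exact mem_insert_self _ _, h.2.symm⟩⟩
    omega
  have hnoadjW : degIn D Sᶜ w = 0 → ∀ y ∈ (Sᶜ \ P) \ Q, ∀ y' ∈ (Sᶜ \ P) \ Q, ¬ D.Adj y y' := by
    rw [hP, hQ, hS]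
    exact fun hw y hy y' hy' => not_adj_of_degIn_compl_eq_zero D hT hw hy hy'
  have hnoadjV : degIn D Sᶜ v = 0 → ∀ y ∈ (Sᶜ \ P) \ Q, ∀ y' ∈ (Sᶜ \ P) \ Q, ¬ D.Adj y y' := by
    have hT' : ∀ a b c, D.Adj a b → D.Adj a c → D.Adj b c → a = u ∨ a = w ∨ a = v := by
      intro a b c hab hac hbc
      rcases hT a b c hab hac hbc with h | h | h
      · exact Or.inl h
      · exact Or.inr (Or.inr h)
      · exact Or.inr (Or.inl h)
    rw [hP, hQ, hS, ← triple_comm_mid u v w]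
    exact fun hv y hy y' hy' => not_adj_of_degIn_compl_eq_zero D hT' hv hy hy'
  -- the numbers
  have hn : Fintype.card V = Sᶜ.card + 3 := by
    rw [card_compl, h3]
    have : S.card ≤ Fintype.card V := card_le_univ _
    rw [h3] at this
    omega
  have ht : P.card = degIn D Sᶜ u := by rw [hP]; exact card_priv_eq D S u
  have hp := sum_private_eq D huv huw hvw
  have hσ := sigma_eq_split D huv huw hvw
  rw [← hS] at hp hσ
  have hsum_s : ∑ z ∈ Sᶜ, degIn D S z + Q.card = Sᶜ.card := by
    have hc := card_filter_add_card_filter_not (fun z => degIn D S z = 0) (s := Sᶜ)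
    have h1 : ∑ z ∈ Sᶜ, degIn D S z = (Sᶜ.filter (fun z => ¬ degIn D S z = 0)).card := by
      rw [card_eq_sum_ones, sum_filter]
      apply sum_congr rfl
      intro z hz
      have := hone z hz
      by_cases h0 : degIn D S z = 0
      · simp only [h0, not_true_eq_false, if_false]
      · simp only [h0, not_false_eq_true, if_true]; omega
    rw [hQ]
    omega
  have hcomm := sum_degIn_comm D S Sᶜ
  have hdens := two_mul_card_edges_eq_adjPairs_add D S
  have hQ6 : adjPairs D S = 6 := by
    rw [adjPairs_eq_sum_degIn]
    calc ∑ x ∈ S, degIn D S x = ∑ _x ∈ S, 2 := sum_congr rfl (fun x hx => degIn_self_of_clique D h3 hcl hx)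
      _ = 6 := by rw [sum_const, h3, smul_eq_mul]
  rw [hQ6] at hdens
  have hsplitR := sum_degIn_compl_split D S P hPS hPind
  have hRcard : (Sᶜ \ P).card + P.card = Sᶜ.card := card_sdiff_add_card_eq_card hPS
  have hYcard : ((Sᶜ \ P) \ Q).card + Q.card = (Sᶜ \ P).card := card_sdiff_add_card_eq_card hQR
  have hsR : ∑ y ∈ Sᶜ \ P, degIn D P y = ∑ y ∈ (Sᶜ \ P) \ Q, degIn D P y + ∑ z ∈ Q, degIn D P z :=
    (sum_sdiff hQR).symm
  have hsY := sum_degIn_le_card_mul D P ((Sᶜ \ P) \ Q)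
  have hDout := sum_outer_degIn_split D S P Q hPS
  have hdQ := sum_degIn_R_le D (Sᶜ \ P) Q hQR
  have houter := two_mul_card_outer_le_sum D S hdeg
  have hBC : ∑ y ∈ Sᶜ \ P, degIn D P y * degIn D P y ≤ ∑ y ∈ Sᶜ \ P, degIn D P y * P.card :=
    sum_le_sum (fun y _ => Nat.mul_le_mul_left _ (degIn_le_card D P y))
  have hBeq : ∑ y ∈ Sᶜ \ P, degIn D P y * P.card = (∑ y ∈ Sᶜ \ P, degIn D P y) * P.card := by
    rw [sum_mul]
  have hsRall := sum_degIn_le_card_mul D P (Sᶜ \ P)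
  have hqRall : ∑ y ∈ Sᶜ \ P, degIn D (Sᶜ \ P) y ≤ (Sᶜ \ P).card * ((Sᶜ \ P).card - 1) :=
    calc ∑ y ∈ Sᶜ \ P, degIn D (Sᶜ \ P) y ≤ ∑ _y ∈ Sᶜ \ P, ((Sᶜ \ P).card - 1) :=
          sum_le_sum (fun y hy => degIn_le_card_sub_one D hy)
      _ = (Sᶜ \ P).card * ((Sᶜ \ P).card - 1) := by rw [sum_const, smul_eq_mul]
  -- abbreviations
  rw [← hS, ← hP, ← hQ] at *
  rw [hBeq]
  obtain ⟨n, hn'⟩ : ∃ n, Sᶜ.card = n := ⟨_, rfl⟩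
  obtain ⟨t, ht'⟩ : ∃ t, degIn D Sᶜ u = t := ⟨_, rfl⟩
  obtain ⟨tv, htv'⟩ : ∃ tv, degIn D Sᶜ v = tv := ⟨_, rfl⟩
  obtain ⟨tw, htw'⟩ : ∃ tw, degIn D Sᶜ w = tw := ⟨_, rfl⟩
  obtain ⟨q, hq'⟩ : ∃ q, Q.card = q := ⟨_, rfl⟩
  obtain ⟨m, hm'⟩ : ∃ m, D.edgeFinset.card = m := ⟨_, rfl⟩
  obtain ⟨σ, hσ'⟩ : ∃ σ, ∑ x ∈ S, degIn D Sᶜ x * degIn D Sᶜ x = σ := ⟨_, rfl⟩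
  obtain ⟨sR, hsR'⟩ : ∃ sR, ∑ y ∈ Sᶜ \ P, degIn D P y = sR := ⟨_, rfl⟩
  obtain ⟨sY, hsY'⟩ : ∃ sY, ∑ y ∈ (Sᶜ \ P) \ Q, degIn D P y = sY := ⟨_, rfl⟩
  obtain ⟨sQ, hsQ'⟩ : ∃ sQ, ∑ z ∈ Q, degIn D P z = sQ := ⟨_, rfl⟩
  obtain ⟨qR, hqR'⟩ : ∃ qR, ∑ y ∈ Sᶜ \ P, degIn D (Sᶜ \ P) y = qR := ⟨_, rfl⟩
  obtain ⟨dQ, hdQ'⟩ : ∃ dQ, ∑ z ∈ Q, degIn D (Sᶜ \ P) z = dQ := ⟨_, rfl⟩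
  obtain ⟨Dout, hDout'⟩ : ∃ Dout, ∑ z ∈ Q, degIn D Sᶜ z = Dout := ⟨_, rfl⟩
  obtain ⟨C, hC'⟩ : ∃ C, ∑ y ∈ Sᶜ \ P, degIn D P y * degIn D P y = C := ⟨_, rfl⟩
  obtain ⟨r, hr'⟩ : ∃ r, ((Sᶜ \ P) \ Q).card = r := ⟨_, rfl⟩
  obtain ⟨Rc, hRc'⟩ : ∃ Rc, (Sᶜ \ P).card = Rc := ⟨_, rfl⟩
  rw [hn'] at hn hsum_s hRcard
  rw [ht'] at ht hmv hmw
  rw [htv'] at hmv hp hσ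
  rw [htw'] at hmw hp hσ
  rw [ht'] at hp hσ
  rw [hq'] at hsum_s hYcard houter
  rw [hm'] at hdens hm
  rw [hσ'] at hσ
  rw [hsR'] at hsplitR hsR
  rw [hsY', hsQ'] at hsR
  rw [hsY', hr', ht] at hsY
  rw [hsQ', hdQ', hDout'] at hDout
  rw [hqR', hdQ', hr'] at hdQ
  rw [hDout'] at houter
  rw [hqR'] at hsplitR
  rw [hBeq, hC', hsR', ht] at hBC
  rw [hr', hRc'] at hYcard
  rw [hRc'] at hRcard
  rw [hsR', hRc', ht] at hsRall
  rw [hqR', hRc'] at hqRall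
  rw [hn', hσ', hq', hm', hsR', hDout', hC', ht]
  rw [hcomm] at hp
  have hp' : n = t + tv + tw + q := by omega
  clear hp
  -- the facts, in numbers:
  -- hn : k = n + 3; hp : n − q = t + tv + tw; hσ : σ ≤ t² + (tv + tw)²; hdens : 2m = 6 + 2(n − q) + 2 sR + qR;
  -- hsR : sR = sY + sQ; hsY : sY ≤ r t; hDout : Dout = sQ + dQ; hdQ : qR ≤ 2 dQ + r (r − 1); houter : 2q ≤ Dout;
  -- hBC : C ≤ sR t; hRcard : Rc + t = n; hYcard : r + q = Rc; hmv, hmw : tv, tw ≤ t; hm : m + 20 = 4 (n + 3);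
  -- hsRall : sR ≤ Rc t; hqRall : qR ≤ Rc (Rc − 1)
  rw [hn] at hm hk
  have hk10 : 10 ≤ n := by omega
  have hr : r = tv + tw := by omega
  subst hr
  have hRc : Rc = tv + tw + q := by omega
  subst hRc
  subst hp'
  have hmval : m = 4 * (t + tv + tw + q) - 8 := by omega
  subst hmval
  rcases Nat.eq_zero_or_pos q with hq0 | hq1
  · -- NO OUTER VERTEX
    subst hq0
    have hQe : Q = ∅ := card_eq_zero.mp hq'
    have hsQ0 : sQ = 0 := by rw [← hsQ', hQe, sum_empty]
    have hdQ0 : dQ = 0 := by rw [← hdQ', hQe, sum_empty]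
    have hDout0 : Dout = 0 := by rw [← hDout', hQe, sum_empty]
    have hYR : (Sᶜ \ P) \ Q = Sᶜ \ P := by rw [hQe, sdiff_empty]
    rcases Nat.lt_or_ge (tv + tw) 3 with hr2 | hr3
    · -- `r ≤ 2`: not dense
      exfalso
      have hsRle : sR ≤ (tv + tw) * t := by linarith
      have hqRle : qR ≤ (tv + tw) * (tv + tw - 1) := by
        have e : tv + tw + 0 = tv + tw := by omega
        rw [e] at hqRall
        exact hqRall
      interval_cases hvtw : (tv + tw) <;> omega
    rcases Nat.lt_or_ge (tv + tw) 4 with hr3' | hr4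
    · -- `r = 3`
      have hr3e : tv + tw = 3 := by omega
      have ht7 : 7 ≤ t := by omega
      rw [hDout0]
      have e3 : 4 * (t + tv + tw + 0) - 8 = 4 * t + 4 := by omega
      rw [e3]
      by_cases hpos : 1 ≤ tv ∧ 1 ≤ tw
      · -- both private sets non-empty: `σ` alone
        clear hsR' hsY' hsQ' hqR' hdQ' hDout' hC' hn' ht' htv' htw' hq' hm' hσ' hr' hRc' hsplitR hdens hsR hsY
          hDout hdQ houter hBeq hYcard hRcard hmv hmw hsum_s hcomm hnotri hone hPind hPS hQR hQe hsQ0 hdQ0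
          hYR hq hT hdeg hK hcl h3 hS hP hQ huv huw hvw hk hn hk10 hm e3 hsRall hqRall hDout0 hr3 hr3'
        have htv2 : tv ≤ 2 := by omega
        have htw2 : tw ≤ 2 := by omega
        interval_cases tv <;> interval_cases tw <;> (ring_nf at hσ hBC ⊢; linarith)
      · -- one private set empty: no edge in `R`, `Σ a_y = 3t − 2`, `A_P ≥ 2 (t − 2)`
        have hnoadj : ∀ y ∈ Sᶜ \ P, ∀ y' ∈ Sᶜ \ P, ¬ D.Adj y y' := by
          intro y hy y' hy'
          have hy2 : y ∈ (Sᶜ \ P) \ Q := by rw [hYR]; exact hy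
          have hy'2 : y' ∈ (Sᶜ \ P) \ Q := by rw [hYR]; exact hy'
          rcases Nat.lt_or_ge tv 1 with h0 | h0
          · exact hnoadjV (by rw [htv']; omega) y hy2 y' hy'2
          · exact hnoadjW (by rw [htw']; omega) y hy2 y' hy'2
        have hqR0 : qR = 0 := by
          rw [← hqR']
          apply sum_eq_zero
          intro y hy
          unfold degIn
          rw [card_eq_zero, filter_eq_empty_iff]
          intro y' hy' hadj
          exact hnoadj y hy y' hy' hadj
        have hsR2 : sR + 2 = 3 * t := by omega
        have hRc3 : (Sᶜ \ P).card = 3 := by rw [hRc']; omega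
        have hdef := sum_sq_le_of_deficit (Sᶜ \ P) (degIn D P) t 2
          (fun y _ => by rw [← ht]; exact degIn_le_card D P y) (by rw [hsR', hRc3]; omega)
        rw [hC', hsR', hRc3] at hdef
        have hmul : (sR + 2) * t = 3 * t * t := by rw [hsR2]
        have hσ9 : tv * tv + tw * tw = 9 := by
          have : tv = 0 ∨ tw = 0 := by omega
          rcases this with h | h
          · subst h; have : tw = 3 := by omega
            subst this; norm_num
          · subst h; have : tv = 3 := by omega
            subst this; norm_num
        clear hsR' hsY' hsQ' hqR' hdQ' hDout' hC' hn' ht' htv' htw' hq' hm' hσ' hr' hRc' hsplitR hdens hsR hsY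
          hDout hdQ houter hBeq hYcard hRcard hmv hmw hsum_s hcomm hnotri hone hPind hPS hQR hQe hsQ0 hdQ0
          hYR hq hT hdeg hK hcl h3 hS hP hQ huv huw hvw hk hn hk10 hm e3 hsRall hqRall hDout0 hr3 hr3'
          hnoadj hqR0 hpos hBC hnoadjV hnoadjW hRc3
        have e4 : t + tv + tw + 0 = t + 3 := by omega
        rw [e4]
        ring_nf at hσ hdef hmul hσ9 ⊢
        nlinarith [hσ, hdef, hmul, hσ9, ht7]
    · -- `r ≥ 4`: `σ` alone
      have ht4 : 4 ≤ t := by omega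
      rw [hDout0]
      have e3 : 4 * (t + tv + tw + 0) - 8 = 4 * (t + tv + tw) - 8 := by omega
      rw [e3]
      obtain ⟨t', rfl⟩ : ∃ t', t = t' + 4 := ⟨t - 4, by omega⟩
      obtain ⟨s', hs'⟩ : ∃ s', tv + tw = s' + 4 := ⟨tv + tw - 4, by omega⟩
      have hlink : (t' + 4) * (tv + tw) = (t' + 4) * (s' + 4) := by rw [hs']
      clear hsR' hsY' hsQ' hqR' hdQ' hDout' hC' hn' ht' htv' htw' hq' hm' hσ' hr' hRc' hsplitR hdens hsR hsY
        hDout hdQ houter hBeq hYcard hRcard hmv hmw hsum_s hcomm hnotri hone hPind hPS hQR hQe hsQ0 hdQ0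
        hYR hq hT hdeg hK hcl h3 hS hP hQ huv huw hvw hk hn hk10 hm e3 hsRall hqRall hDout0 hr3 ht4
      have hm4 : 4 * (t' + 4 + tv + tw) - 8 + 8 = 4 * (t' + 4 + tv + tw) := by omega
      obtain ⟨m4, hm4'⟩ : ∃ m4, 4 * (t' + 4 + tv + tw) - 8 = m4 := ⟨_, rfl⟩
      rw [hm4'] at hm4 ⊢
      have e5 : t' + 4 + tv + tw + 0 = t' + 4 + tv + tw := by omega
      rw [e5]
      ring_nf at hσ hBC hm4 hlink hs' ⊢
      nlinarith [hσ, hBC, hm4, hlink, hs', Nat.zero_le (t' * s'), Nat.zero_le (tv * tw)]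
  · -- EXACTLY ONE OUTER VERTEX
    have hq1' : q = 1 := by omega
    subst hq1'
    rcases Nat.lt_or_ge (tv + tw) 2 with hr1 | hr2
    · -- `r ≤ 1`: not dense
      exfalso
      have hqRle : qR ≤ (tv + tw + 1) * (tv + tw + 1 - 1) := hqRall
      have hsRle : sR ≤ (tv + tw + 1) * t := hsRall
      interval_cases hvtw : (tv + tw) <;> omega
    rcases Nat.lt_or_ge (tv + tw) 3 with hr2' | hr3
    · -- `r = 2`: the exact outer accounting
      have hr2e : tv + tw = 2 := by omega
      have ht7 : 7 ≤ t := by omega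
      have hsYle : sY ≤ 2 * t := by rw [hr2e] at hsY; exact hsY
      have hdQ2 : qR ≤ 2 * dQ + 2 := by rw [hr2e] at hdQ; exact hdQ
      have hmain : 2 * t ≤ 2 * Dout + 4 := by
        have h1 : 2 * D.edgeFinset.card = 2 * (4 * (t + tv + tw + 1) - 8) := by rw [hm']
        have h2 : 2 * (4 * (t + tv + tw + 1) - 8) + 16 = 8 * (t + tv + tw + 1) := by omega
        omega
      have hσ4 : tv * tv + tw * tw ≤ 4 := by
        have : tv ≤ 2 := by omega
        have : tw ≤ 2 := by omega
        interval_cases tv <;> interval_cases tw <;> omega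
      have e3 : 4 * (t + tv + tw + 1) - 8 = 4 * t + 4 := by omega
      rw [e3]
      have e4 : t + tv + tw + 1 = t + 3 := by omega
      rw [e4]
      clear hsR' hsY' hsQ' hqR' hdQ' hDout' hC' hn' ht' htv' htw' hq' hm' hσ' hr' hRc' hsplitR hdens hsR hsY
        hDout hdQ houter hBeq hYcard hRcard hmv hmw hsum_s hcomm hnotri hone hPind hPS hQR hq hT hdeg hK hcl h3
        hS hP hQ huv huw hvw hk hn hk10 hm e3 e4 hsRall hqRall hr2 hr2' hsYle hdQ2 hr2e
      ring_nf at hσ hBC hmain hσ4 ⊢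
      nlinarith [hσ, hBC, hmain, hσ4, ht7]
    · -- `r ≥ 3`: `D_out ≥ 2`
      have ht3 : 3 ≤ t := by omega
      have e3 : 4 * (t + tv + tw + 1) - 8 = 4 * (t + tv + tw) - 4 := by omega
      rw [e3]
      obtain ⟨t', rfl⟩ : ∃ t', t = t' + 3 := ⟨t - 3, by omega⟩
      obtain ⟨s', hs'⟩ : ∃ s', tv + tw = s' + 3 := ⟨tv + tw - 3, by omega⟩
      have hlink : (t' + 3) * (tv + tw) = (t' + 3) * (s' + 3) := by rw [hs']
      clear hsR' hsY' hsQ' hqR' hdQ' hDout' hC' hn' ht' htv' htw' hq' hm' hσ' hr' hRc' hsplitR hdens hsR hsY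
        hDout hdQ hBeq hYcard hRcard hmv hmw hsum_s hcomm hnotri hone hPind hPS hQR hq hT hdeg hK hcl h3
        hS hP hQ huv huw hvw hk hn hk10 hm e3 hsRall hqRall hr2 hr3 ht3
      have hm4 : 4 * (t' + 3 + tv + tw) - 4 + 4 = 4 * (t' + 3 + tv + tw) := by omega
      obtain ⟨m4, hm4'⟩ : ∃ m4, 4 * (t' + 3 + tv + tw) - 4 = m4 := ⟨_, rfl⟩
      rw [hm4'] at hm4 ⊢
      ring_nf at hσ hBC hm4 hlink hs' houter ⊢
      nlinarith [hσ, hBC, hm4, hlink, hs', houter, Nat.zero_le (t' * s'), Nat.zero_le (tv * tw)]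

end C047

end TriangleCap

end PercRepro
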